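/-
Copyright: the b2b-balaban T⁴-continuum CRUX team, row NE7b OWNER lineage `t4-ne7b-p1` (gen 136). Project licence.
-/
import Summits.QuantumFields.BalabanUV.T4Continuum.Spine.NE7b.SupBlockStepLineDerivatives
import Summits.QuantumFields.BalabanUV.T4Continuum.Spine.NE7b.SupNextPotentialCubicTaylor

/-!
# THE CUBIC LETTER OF THE NEXT POTENTIAL OF A BLOCK-LOCAL INPUT — (337b)∕(338)'s BLOCK TWIN: for a `C³` block potential `U` with the block
# letters (`κ₀, κ₁, a, κ₂, κ₃`), along every line `ψ₀ + t·h`, `log Z` (`Z(t) = ∫e^{−U(ω+ψ₀+th)}dN(0,Γ)`) is `C³` with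
# `(log Z)′ = Z₁∕Z`, `(Z₁∕Z)′ = (Z₂Z − Z₁²)∕Z²`, `((Z₂Z − Z₁²)∕Z²)′ = (z₃Z² − 3ZZ₁Z₂ + 2Z₁³)∕Z³` ((405) + (337a) BY NAME) and, under the BLOCK
# TILTED GRADIENT-MOMENT LETTERS `∫e^{−U}‖U′(u)‖ᵏ ≤ Z·m_k` (`k = 1, 2, 3`, `u = ω + ψ₀ + th`),
#   `|(log Z)‴(t)| ≤ ‖h‖³·𝔪`,  `𝔪 = (m₃ + 3κ₂m₁ + κ₃) + 3m₁(m₂ + κ₂) + 2m₁³`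
# — honestly O(‖h‖³); with the letters UNIFORM on the segment, (338)(A)'s third-order Taylor estimate gives THE CUBIC TAYLOR LETTER
#   `|log Z(ψ₀+h) − log Z(ψ₀) + Z⁻¹∫e^{−U}U′[h] + ½(Z⁻¹∫e^{−U}(U″[h,h] − U′[h]²) + Z⁻²(∫e^{−U}U′[h])²)| ≤ ‖h‖³𝔪∕6`
# i.e. the remainder after extracting (399)'s gradient `⟨b_D,h⟩` and (403)'s Hessian `hᵀK_Dh` ((404)) of a BLOCK-LOCAL input is third order —
# (389)'s cubic letter for block inputs (row NE7b, node U5c; (405)∕(337a)∕(338)∕(337b) BY NAME; [folklore])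

Cell `pub-balaban`, sub-cell `t4`, spine estimate NE7b (`T4WeightBudget.RelWeightBound`; the cell's OWN estimate — NOT PRINTED in
[Bałaban 1983–89], NOT PROVED).  Crux-route work under `Spine/NE7b/` by the row OWNER (`t4-ne7b-p1` gen 136, file (406)) under FREEZE
(0)'s crux-prover clause, on this gen's SCOPING-d8 DECISION (d8′)(2); NOTHING of Bałaban's is named as a Lean object, valued or asserted;
no `T4Continuum/Support` leaf typed; no `def`, no notation; zero `sorry`.  Imports (BY NAME): the OWNER's (405) `…SupBlockStepLineDerivatives`
(`block_line_derivs`, `norm_F3_le`), (338) `…SupNextPotentialCubicTaylor` (`taylor_third_abs_one`) and through them (337a) (`hasDerivAt_log_of`,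
`hasDerivAt_logDeriv_of`, `hasDerivAt_logSecond_of`, `abs_logThird_le`), (337b) (`abs_integral_div_le_of_dominated`), (399)
(`integrable_exp_neg_block`), (313) (`mul_opBound_le_of_le`).

WHAT IS PROVED ([folklore]): §1 `blockZ_pos` (`Z(t) > 0`), the three quotient letters `abs_blockZ1_div_le` (`|Z₁|∕Z ≤ ‖h‖m₁`), `abs_blockZ2_div_le`
(`|Z₂|∕Z ≤ ‖h‖²(m₂ + κ₂)`), `abs_blockZ3_div_le` (`|z₃|∕Z ≤ ‖h‖³(m₃ + 3κ₂m₁ + κ₃)`); §2 `block_logZ_derivs` (`log Z` is `C²` along the line with the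
quotient derivatives), **`block_third_letter`** (`(log Z)″` differentiable at `t₀` and `|(log Z)‴(t₀)| ≤ ‖h‖³𝔪`); §3 THE END **`block_cubic_taylor`**
(the three Taylor remainders between `t = 0` and `t = 1` are at most `‖h‖³𝔪∕6`, `‖h‖³𝔪∕2`, `‖h‖³𝔪` under the letters uniform on `[0,1]`); §4 toy.

HONEST (what this is NOT).  Bookkeeping over (405); the block tilted gradient-moment letters `m₁, m₂, m₃` (with the integrability of
`e^{−U}‖U′‖ᵏ`) are HYPOTHESES — their discharge for a block input ((339)'s twin: crude from the dominations, uniform only on a small-field region)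
and the re-run of (386)∕(389)∕(391)∕(394) with `U` in place of `Σw` remain; scalar skeleton ((A3), NC-NE7b-α UNRULED); nothing of Bałaban's
asserted.  BY-NAME EFFECT ON THE WALL: NONE.  NE7b NOT PRINTED ∕ NOT PROVED; spine PROVED 0∕9; rung (B)+1 — the programme's measures remain
FINITE-torus statements; NOT the mass gap, NOT Clay.  HONEST DEPENDENCY: continuum YM on T⁴ ⇐ BetaPertH ∧ nine spine estimates (0∕9 proved);
BetaPertH ⇐ (D1) ∧ (D4) ∧ CAP+tail; G-an2-4 gates asym, D1 and NE2∕3∕4.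
-/

set_option autoImplicit false
set_option maxSynthPendingDepth 2

noncomputable section

namespace Summit.QuantumFields.BalabanUV.T4Continuum.NE7b.SupBlockThirdLetter

open MeasureTheory ProbabilityTheory Finset Real Set
open scoped BigOperators
open SupBlockStepLineDerivatives (block_line_derivs norm_F3_le)
open SupNextPotentialCubicTaylor (taylor_third_abs_one)
open SupLogThirdDerivative (hasDerivAt_log_of hasDerivAt_logDeriv_of hasDerivAt_logSecond_of abs_logThird_le)
open SupNextPotentialThirdLetter (abs_integral_div_le_of_dominated)
open SupBlockEffectiveActionDerivative (integrable_exp_neg_block)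
open SupEffectiveActionDerivative (mul_opBound_le_of_le)

variable {ι : Type} [Fintype ι] [DecidableEq ι]

section Main

variable {Γ : Matrix ι ι ℝ} {γop : ℝ} {U : EuclideanSpace ℝ ι → ℝ} {U' : EuclideanSpace ℝ ι → EuclideanSpace ℝ ι →L[ℝ] ℝ}
  {U'' : EuclideanSpace ℝ ι → EuclideanSpace ℝ ι →L[ℝ] EuclideanSpace ℝ ι →L[ℝ] ℝ}
  {U₃ : EuclideanSpace ℝ ι → EuclideanSpace ℝ ι →L[ℝ] EuclideanSpace ℝ ι →L[ℝ] EuclideanSpace ℝ ι →L[ℝ] ℝ} {κ₀ κ₁ κ₂ κ₃ a τ δ θ : ℝ}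

/-! ## §1. `Z > 0` and the three quotient letters -/

/-- `Z(t) = ∫e^{−U(ω+ψ₀+th)}dN(0,Γ) > 0` and the integrand is integrable ((399) + positivity). [folklore] -/
theorem blockZ_pos (hΓ : Γ.PosSemidef) (hΓop : (γop • (1 : Matrix ι ι ℝ) - Γ).PosSemidef) (Y : Finset ι)
    (hUd : ∀ φ : EuclideanSpace ℝ ι, HasFDerivAt U (U' φ) φ) (hκ₀ : 0 ≤ κ₀) (hτ : 0 < τ) (hδ : 0 < δ) (hθ0 : 0 < θ) (hθ1 : θ < 1)
    (hκθ : (2 * κ₀ * (1 + τ) + 4 * δ) * γop ≤ θ) (hstab : ∀ φ : EuclideanSpace ℝ ι, -(κ₀ * ∑ x ∈ Y, φ x ^ 2) ≤ U φ) (ψ₀ h : EuclideanSpace ℝ ι) (t : ℝ) :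
    Integrable (fun ω : EuclideanSpace ℝ ι => exp (-U (ω + (ψ₀ + t • h)))) (multivariateGaussian 0 Γ) ∧ 0 < (∫ ω : EuclideanSpace ℝ ι, exp (-U (ω + (ψ₀ + t • h)))
        ∂(multivariateGaussian 0 Γ)) := by
  have hUm : Measurable U := (continuous_iff_continuousAt.2 fun φ => (hUd φ).continuousAt).measurable
  have hκθ₀ : 2 * κ₀ * (1 + τ) * γop ≤ θ := mul_opBound_le_of_le (by positivity) (by linarith) hθ0.le hκθ
  have hI := integrable_exp_neg_block hΓ hΓop Y hUm hκ₀ hτ hθ1 hκθ₀ hstab (ψ₀ + t • h)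
  exact ⟨hI, integral_exp_pos hI⟩

/-- **`|Z₁|∕Z ≤ ‖h‖m₁`**: `|e^{−U}(−A)| ≤ ‖h‖·e^{−U}‖U′(u)‖`, integrated, under the first moment letter. [folklore] -/
theorem abs_blockZ1_div_le (hΓ : Γ.PosSemidef) (hΓop : (γop • (1 : Matrix ι ι ℝ) - Γ).PosSemidef) (Y : Finset ι)
    (hUd : ∀ φ : EuclideanSpace ℝ ι, HasFDerivAt U (U' φ) φ) (hκ₀ : 0 ≤ κ₀) (hτ : 0 < τ) (hδ : 0 < δ) (hθ0 : 0 < θ) (hθ1 : θ < 1)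
    (hκθ : (2 * κ₀ * (1 + τ) + 4 * δ) * γop ≤ θ) (hstab : ∀ φ : EuclideanSpace ℝ ι, -(κ₀ * ∑ x ∈ Y, φ x ^ 2) ≤ U φ) (ψ₀ h : EuclideanSpace ℝ ι) (t : ℝ) {m₁ : ℝ}
    (hI1 : Integrable (fun ω : EuclideanSpace ℝ ι => exp (-U (ω + (ψ₀ + t • h))) * ‖U' (ω + (ψ₀ + t • h))‖) (multivariateGaussian 0 Γ))
    (hm1 : ∫ ω : EuclideanSpace ℝ ι, exp (-U (ω + (ψ₀ + t • h))) * ‖U' (ω + (ψ₀ + t • h))‖ ∂(multivariateGaussian 0 Γ) ≤ (∫ ω : EuclideanSpace ℝ ι, exp (-U (ω + (ψ₀ + t •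
        h))) ∂(multivariateGaussian 0 Γ)) * m₁) :
    |(∫ ω : EuclideanSpace ℝ ι, exp (-U (ω + (ψ₀ + t • h))) * -(U' (ω + (ψ₀ + t • h)) h) ∂(multivariateGaussian 0 Γ))| / (∫ ω : EuclideanSpace ℝ ι, exp (-U (ω + (ψ₀ + t •
        h))) ∂(multivariateGaussian 0 Γ)) ≤ ‖h‖ * m₁ := by
  have hZ := (blockZ_pos hΓ hΓop Y hUd hκ₀ hτ hδ hθ0 hθ1 hκθ hstab ψ₀ h t).2
  refine abs_integral_div_le_of_dominated (μ := (multivariateGaussian 0 Γ)) hZ (hI1.const_mul ‖h‖) (fun ω => ?_) ?_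
  · rw [abs_mul, abs_neg, abs_of_pos (exp_pos _)]
    have hA : |U' (ω + (ψ₀ + t • h)) h| ≤ ‖U' (ω + (ψ₀ + t • h))‖ * ‖h‖ := by
      rw [← Real.norm_eq_abs]; exact ContinuousLinearMap.le_opNorm _ _
    nlinarith [exp_pos (-U (ω + (ψ₀ + t • h))), norm_nonneg h]
  · rw [integral_const_mul]
    nlinarith [norm_nonneg h]

/-- **`|Z₂|∕Z ≤ ‖h‖²(m₂ + κ₂)`**: `|e^{−U}(A·A − B)| ≤ ‖h‖²(e^{−U}‖U′(u)‖² + κ₂e^{−U})`, integrated, under the second moment letter. [folklore] -/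
theorem abs_blockZ2_div_le (hΓ : Γ.PosSemidef) (hΓop : (γop • (1 : Matrix ι ι ℝ) - Γ).PosSemidef) (Y : Finset ι)
    (hUd : ∀ φ : EuclideanSpace ℝ ι, HasFDerivAt U (U' φ) φ) (hκ₀ : 0 ≤ κ₀) (hτ : 0 < τ) (hδ : 0 < δ) (hθ0 : 0 < θ) (hθ1 : θ < 1)
    (hκθ : (2 * κ₀ * (1 + τ) + 4 * δ) * γop ≤ θ) (hstab : ∀ φ : EuclideanSpace ℝ ι, -(κ₀ * ∑ x ∈ Y, φ x ^ 2) ≤ U φ) (ψ₀ h : EuclideanSpace ℝ ι) (hU''b : ∀ φ :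
        EuclideanSpace ℝ ι, ‖U'' φ‖ ≤ κ₂) (t : ℝ) {m₂ : ℝ}
    (hI2 : Integrable (fun ω : EuclideanSpace ℝ ι => exp (-U (ω + (ψ₀ + t • h))) * ‖U' (ω + (ψ₀ + t • h))‖ ^ 2) (multivariateGaussian 0 Γ))
    (hm2 : ∫ ω : EuclideanSpace ℝ ι, exp (-U (ω + (ψ₀ + t • h))) * ‖U' (ω + (ψ₀ + t • h))‖ ^ 2 ∂(multivariateGaussian 0 Γ) ≤ (∫ ω : EuclideanSpace ℝ ι, exp (-U (ω + (ψ₀ + t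
        • h))) ∂(multivariateGaussian 0 Γ)) * m₂) :
    |(∫ ω : EuclideanSpace ℝ ι, exp (-U (ω + (ψ₀ + t • h))) * (U' (ω + (ψ₀ + t • h)) h * U' (ω + (ψ₀ + t • h)) h - U'' (ω + (ψ₀ + t • h)) h h) ∂(multivariateGaussian 0 Γ))|
        / (∫ ω : EuclideanSpace ℝ ι, exp (-U (ω + (ψ₀ + t • h))) ∂(multivariateGaussian 0 Γ)) ≤ ‖h‖ ^ 2 * (m₂ + κ₂) := by
  obtain ⟨hE, hZ⟩ := blockZ_pos hΓ hΓop Y hUd hκ₀ hτ hδ hθ0 hθ1 hκθ hstab ψ₀ h t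
  have hκ₂ : 0 ≤ κ₂ := (norm_nonneg (U'' 0)).trans (hU''b 0)
  refine abs_integral_div_le_of_dominated (μ := (multivariateGaussian 0 Γ)) hZ ((hI2.add (hE.const_mul κ₂)).const_mul (‖h‖ ^ 2)) (fun ω => ?_) ?_
  · rw [abs_mul, abs_of_pos (exp_pos _)]
    have hA : |U' (ω + (ψ₀ + t • h)) h| ≤ ‖U' (ω + (ψ₀ + t • h))‖ * ‖h‖ := by
      rw [← Real.norm_eq_abs]; exact ContinuousLinearMap.le_opNorm _ _
    have hB : |U'' (ω + (ψ₀ + t • h)) h h| ≤ κ₂ * ‖h‖ * ‖h‖ := by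
      rw [← Real.norm_eq_abs]
      calc ‖U'' (ω + (ψ₀ + t • h)) h h‖ ≤ ‖U'' (ω + (ψ₀ + t • h))‖ * ‖h‖ * ‖h‖ := ContinuousLinearMap.le_opNorm₂ _ _ _
        _ ≤ κ₂ * ‖h‖ * ‖h‖ := by gcongr; exact hU''b _
    have hAA : |U' (ω + (ψ₀ + t • h)) h * U' (ω + (ψ₀ + t • h)) h| ≤ (‖U' (ω + (ψ₀ + t • h))‖ * ‖h‖) ^ 2 := by
      rw [abs_mul, pow_two]; exact mul_le_mul hA hA (abs_nonneg _) ((abs_nonneg _).trans hA)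
    have hsub := abs_sub (U' (ω + (ψ₀ + t • h)) h * U' (ω + (ψ₀ + t • h)) h) (U'' (ω + (ψ₀ + t • h)) h h)
    have hE0 := exp_pos (-U (ω + (ψ₀ + t • h)))
    simp only [Pi.add_apply]
    nlinarith
  · simp only [Pi.add_apply]
    rw [integral_const_mul, integral_add hI2 (hE.const_mul κ₂), integral_const_mul]
    have hh : 0 ≤ ‖h‖ ^ 2 := by positivity
    nlinarith [mul_le_mul_of_nonneg_left hm2 hh]

/-- **`|z₃|∕Z ≤ ‖h‖³(m₃ + 3κ₂m₁ + κ₃)`**: (405)'s `norm_F3_le` integrated under the first and third moment letters. [folklore] -/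
theorem abs_blockZ3_div_le (hΓ : Γ.PosSemidef) (hΓop : (γop • (1 : Matrix ι ι ℝ) - Γ).PosSemidef) (Y : Finset ι)
    (hUd : ∀ φ : EuclideanSpace ℝ ι, HasFDerivAt U (U' φ) φ) (hκ₀ : 0 ≤ κ₀) (hτ : 0 < τ) (hδ : 0 < δ) (hθ0 : 0 < θ) (hθ1 : θ < 1)
    (hκθ : (2 * κ₀ * (1 + τ) + 4 * δ) * γop ≤ θ) (hstab : ∀ φ : EuclideanSpace ℝ ι, -(κ₀ * ∑ x ∈ Y, φ x ^ 2) ≤ U φ) (ψ₀ h : EuclideanSpace ℝ ι) (hU''b : ∀ φ :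
        EuclideanSpace ℝ ι, ‖U'' φ‖ ≤ κ₂)
    (hU₃b : ∀ φ : EuclideanSpace ℝ ι, ‖U₃ φ‖ ≤ κ₃) (t : ℝ) {m₁ m₃ : ℝ}
    (hI1 : Integrable (fun ω : EuclideanSpace ℝ ι => exp (-U (ω + (ψ₀ + t • h))) * ‖U' (ω + (ψ₀ + t • h))‖) (multivariateGaussian 0 Γ))
    (hm1 : ∫ ω : EuclideanSpace ℝ ι, exp (-U (ω + (ψ₀ + t • h))) * ‖U' (ω + (ψ₀ + t • h))‖ ∂(multivariateGaussian 0 Γ) ≤ (∫ ω : EuclideanSpace ℝ ι, exp (-U (ω + (ψ₀ + t •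
        h))) ∂(multivariateGaussian 0 Γ)) * m₁)
    (hI3 : Integrable (fun ω : EuclideanSpace ℝ ι => exp (-U (ω + (ψ₀ + t • h))) * ‖U' (ω + (ψ₀ + t • h))‖ ^ 3) (multivariateGaussian 0 Γ))
    (hm3 : ∫ ω : EuclideanSpace ℝ ι, exp (-U (ω + (ψ₀ + t • h))) * ‖U' (ω + (ψ₀ + t • h))‖ ^ 3 ∂(multivariateGaussian 0 Γ) ≤ (∫ ω : EuclideanSpace ℝ ι, exp (-U (ω + (ψ₀ + t
        • h))) ∂(multivariateGaussian 0 Γ)) * m₃) :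
    |(∫ ω : EuclideanSpace ℝ ι, exp (-U (ω + (ψ₀ + t • h))) * (-(U' (ω + (ψ₀ + t • h)) h * U' (ω + (ψ₀ + t • h)) h * U' (ω + (ψ₀ + t • h)) h) + 3 * U' (ω + (ψ₀ + t • h)) h
        * U'' (ω + (ψ₀ + t • h)) h h - U₃ (ω + (ψ₀ + t • h)) h h h) ∂(multivariateGaussian 0 Γ))| / (∫ ω : EuclideanSpace ℝ ι, exp (-U (ω + (ψ₀ + t • h)))
        ∂(multivariateGaussian 0 Γ)) ≤
      ‖h‖ ^ 3 * (m₃ + 3 * κ₂ * m₁ + κ₃) := by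
  obtain ⟨hE, hZ⟩ := blockZ_pos hΓ hΓop Y hUd hκ₀ hτ hδ hθ0 hθ1 hκθ hstab ψ₀ h t
  have hκ₂ : 0 ≤ κ₂ := (norm_nonneg (U'' 0)).trans (hU''b 0)
  have hG : Integrable (fun ω : EuclideanSpace ℝ ι => ‖h‖ ^ 3 * (exp (-U (ω + (ψ₀ + t • h))) * ‖U' (ω + (ψ₀ + t • h))‖ ^ 3 +
      3 * κ₂ * (exp (-U (ω + (ψ₀ + t • h))) * ‖U' (ω + (ψ₀ + t • h))‖) + κ₃ * exp (-U (ω + (ψ₀ + t • h))))) (multivariateGaussian 0 Γ) :=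
    ((hI3.add (hI1.const_mul (3 * κ₂))).add (hE.const_mul κ₃)).const_mul (‖h‖ ^ 3)
  refine abs_integral_div_le_of_dominated (μ := (multivariateGaussian 0 Γ)) hZ hG (fun ω => ?_) ?_
  · have h3 := norm_F3_le (U := U) (U' := U') hU''b hU₃b ω (ψ₀ + t • h) h
    rw [Real.norm_eq_abs] at h3
    exact h3.trans (le_of_eq (by ring))
  · have i12 : Integrable (fun ω : EuclideanSpace ℝ ι => exp (-U (ω + (ψ₀ + t • h))) * ‖U' (ω + (ψ₀ + t • h))‖ ^ 3 + 3 * κ₂ * (exp (-U (ω + (ψ₀ + t • h))) * ‖U' (ω + (ψ₀ +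
      t • h))‖)) (multivariateGaussian 0 Γ) :=
      hI3.add (hI1.const_mul (3 * κ₂))
    have i3 : Integrable (fun ω : EuclideanSpace ℝ ι => κ₃ * exp (-U (ω + (ψ₀ + t • h)))) (multivariateGaussian 0 Γ) := hE.const_mul κ₃
    rw [integral_const_mul, integral_add i12 i3, integral_add hI3 (hI1.const_mul (3 * κ₂)), integral_const_mul, integral_const_mul]
    have hh : 0 ≤ ‖h‖ ^ 3 := by positivity
    have h1 : 3 * κ₂ * ∫ ω : EuclideanSpace ℝ ι, exp (-U (ω + (ψ₀ + t • h))) * ‖U' (ω + (ψ₀ + t • h))‖ ∂(multivariateGaussian 0 Γ) ≤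
        3 * κ₂ * ((∫ ω : EuclideanSpace ℝ ι, exp (-U (ω + (ψ₀ + t • h))) ∂(multivariateGaussian 0 Γ)) * m₁) := mul_le_mul_of_nonneg_left hm1 (by positivity)
    nlinarith [mul_le_mul_of_nonneg_left (add_le_add hm3 h1) hh]

/-! ## §2. `log Z` along the line: the quotient derivatives and the cubic letter -/

/-- **`log Z` is `C²` along every line** with `(log Z)′ = Z₁∕Z` and `(Z₁∕Z)′ = (Z₂Z − Z₁Z₁)∕Z²` at EVERY `t₀` ((405) + (337a)). [folklore] -/
theorem block_logZ_derivs (hΓ : Γ.PosSemidef) (hΓop : (γop • (1 : Matrix ι ι ℝ) - Γ).PosSemidef) (Y : Finset ι)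
    (hUd : ∀ φ : EuclideanSpace ℝ ι, HasFDerivAt U (U' φ) φ) (hU'd : ∀ φ : EuclideanSpace ℝ ι, HasFDerivAt U' (U'' φ) φ)
    (hU''d : ∀ φ : EuclideanSpace ℝ ι, HasFDerivAt U'' (U₃ φ) φ) (hU₃c : Continuous U₃)
    (hκ₀ : 0 ≤ κ₀) (hκ₁ : 0 ≤ κ₁) (ha : 0 ≤ a) (hκ₂ : 0 ≤ κ₂) (hκ₃ : 0 ≤ κ₃) (hτ : 0 < τ) (hδ : 0 < δ) (hθ0 : 0 < θ) (hθ1 : θ < 1)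
    (hκθ : (2 * κ₀ * (1 + τ) + 4 * δ) * γop ≤ θ) (hstab : ∀ φ : EuclideanSpace ℝ ι, -(κ₀ * ∑ x ∈ Y, φ x ^ 2) ≤ U φ)
    (hU'b : ∀ φ : EuclideanSpace ℝ ι, ‖U' φ‖ ≤ κ₁ * (a + ∑ x ∈ Y, φ x ^ 2)) (hU''b : ∀ φ : EuclideanSpace ℝ ι, ‖U'' φ‖ ≤ κ₂)
    (hU₃b : ∀ φ : EuclideanSpace ℝ ι, ‖U₃ φ‖ ≤ κ₃) (ψ₀ h : EuclideanSpace ℝ ι) (t₀ : ℝ) :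
    HasDerivAt (fun t : ℝ => Real.log (∫ ω : EuclideanSpace ℝ ι, exp (-U (ω + (ψ₀ + t • h))) ∂(multivariateGaussian 0 Γ)))
        ((∫ ω : EuclideanSpace ℝ ι, exp (-U (ω + (ψ₀ + t₀ • h))) * -(U' (ω + (ψ₀ + t₀ • h)) h) ∂(multivariateGaussian 0 Γ)) / (∫ ω : EuclideanSpace ℝ ι, exp (-U (ω + (ψ₀ +
            t₀ • h))) ∂(multivariateGaussian 0 Γ))) t₀ ∧
      HasDerivAt (fun t : ℝ => (∫ ω : EuclideanSpace ℝ ι, exp (-U (ω + (ψ₀ + t • h))) * -(U' (ω + (ψ₀ + t • h)) h) ∂(multivariateGaussian 0 Γ)) / (∫ ω : EuclideanSpace ℝ ι,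
          exp (-U (ω + (ψ₀ + t • h))) ∂(multivariateGaussian 0 Γ)))
        (((∫ ω : EuclideanSpace ℝ ι, exp (-U (ω + (ψ₀ + t₀ • h))) * (U' (ω + (ψ₀ + t₀ • h)) h * U' (ω + (ψ₀ + t₀ • h)) h - U'' (ω + (ψ₀ + t₀ • h)) h h)
            ∂(multivariateGaussian 0 Γ)) * (∫ ω : EuclideanSpace ℝ ι, exp (-U (ω + (ψ₀ + t₀ • h))) ∂(multivariateGaussian 0 Γ)) - (∫ ω : EuclideanSpace ℝ ι, exp (-U (ω +
            (ψ₀ + t₀ • h))) * -(U' (ω + (ψ₀ + t₀ • h)) h) ∂(multivariateGaussian 0 Γ)) * (∫ ω : EuclideanSpace ℝ ι, exp (-U (ω + (ψ₀ + t₀ • h))) * -(U' (ω + (ψ₀ + t₀ • h))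
            h) ∂(multivariateGaussian 0 Γ))) / (∫ ω : EuclideanSpace ℝ ι, exp (-U (ω + (ψ₀ + t₀ • h))) ∂(multivariateGaussian 0 Γ)) ^ 2) t₀ := by
  have hZ := (blockZ_pos hΓ hΓop Y hUd hκ₀ hτ hδ hθ0 hθ1 hκθ hstab ψ₀ h t₀).2
  obtain ⟨-, hd1, hd2, -⟩ := block_line_derivs hΓ hΓop Y hUd hU'd hU''d hU₃c hκ₀ hκ₁ ha hκ₂ hκ₃ hτ hδ hθ0 hθ1 hκθ hstab hU'b hU''b hU₃b ψ₀ h t₀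
  exact ⟨hasDerivAt_log_of (Z := fun t : ℝ => (∫ ω : EuclideanSpace ℝ ι, exp (-U (ω + (ψ₀ + t • h))) ∂(multivariateGaussian 0 Γ)))
      (Z₁ := fun t : ℝ => (∫ ω : EuclideanSpace ℝ ι, exp (-U (ω + (ψ₀ + t • h))) * -(U' (ω + (ψ₀ + t • h)) h) ∂(multivariateGaussian 0 Γ))) hd1 hZ,
    hasDerivAt_logDeriv_of (Z := fun t : ℝ => (∫ ω : EuclideanSpace ℝ ι, exp (-U (ω + (ψ₀ + t • h))) ∂(multivariateGaussian 0 Γ)))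
      (Z₁ := fun t : ℝ => (∫ ω : EuclideanSpace ℝ ι, exp (-U (ω + (ψ₀ + t • h))) * -(U' (ω + (ψ₀ + t • h)) h) ∂(multivariateGaussian 0 Γ)))
      (Z₂ := fun t : ℝ => (∫ ω : EuclideanSpace ℝ ι, exp (-U (ω + (ψ₀ + t • h))) * (U' (ω + (ψ₀ + t • h)) h * U' (ω + (ψ₀ + t • h)) h - U'' (ω + (ψ₀ + t • h)) h h)
          ∂(multivariateGaussian 0 Γ))) hd1 hd2 hZ⟩

/-- **THE THIRD-ORDER LETTER OF THE NEXT POTENTIAL OF A BLOCK INPUT ALONG A LINE.**  Under (405)'s hypotheses and the block tilted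
gradient-moment letters at `t₀` (`∫e^{−U}‖U′(u)‖ᵏ ≤ Z·m_k`, `k = 1,2,3`, integrands integrable): `(log Z)″ = (Z₂Z − Z₁Z₁)∕Z²` is differentiable
at `t₀` with derivative `(z₃Z² − 3ZZ₁Z₂ + 2Z₁³)∕Z³`, and `|(log Z)‴(t₀)| ≤ ‖h‖³·((m₃ + 3κ₂m₁ + κ₃) + 3m₁(m₂ + κ₂) + 2m₁³)`. [folklore] -/
theorem block_third_letter (hΓ : Γ.PosSemidef) (hΓop : (γop • (1 : Matrix ι ι ℝ) - Γ).PosSemidef) (Y : Finset ι)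
    (hUd : ∀ φ : EuclideanSpace ℝ ι, HasFDerivAt U (U' φ) φ) (hU'd : ∀ φ : EuclideanSpace ℝ ι, HasFDerivAt U' (U'' φ) φ)
    (hU''d : ∀ φ : EuclideanSpace ℝ ι, HasFDerivAt U'' (U₃ φ) φ) (hU₃c : Continuous U₃)
    (hκ₀ : 0 ≤ κ₀) (hκ₁ : 0 ≤ κ₁) (ha : 0 ≤ a) (hκ₂ : 0 ≤ κ₂) (hκ₃ : 0 ≤ κ₃) (hτ : 0 < τ) (hδ : 0 < δ) (hθ0 : 0 < θ) (hθ1 : θ < 1)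
    (hκθ : (2 * κ₀ * (1 + τ) + 4 * δ) * γop ≤ θ) (hstab : ∀ φ : EuclideanSpace ℝ ι, -(κ₀ * ∑ x ∈ Y, φ x ^ 2) ≤ U φ)
    (hU'b : ∀ φ : EuclideanSpace ℝ ι, ‖U' φ‖ ≤ κ₁ * (a + ∑ x ∈ Y, φ x ^ 2)) (hU''b : ∀ φ : EuclideanSpace ℝ ι, ‖U'' φ‖ ≤ κ₂)
    (hU₃b : ∀ φ : EuclideanSpace ℝ ι, ‖U₃ φ‖ ≤ κ₃) (ψ₀ h : EuclideanSpace ℝ ι) (t₀ : ℝ) {m₁ m₂ m₃ : ℝ}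
    (hI1 : Integrable (fun ω : EuclideanSpace ℝ ι => exp (-U (ω + (ψ₀ + t₀ • h))) * ‖U' (ω + (ψ₀ + t₀ • h))‖) (multivariateGaussian 0 Γ))
    (hm1 : ∫ ω : EuclideanSpace ℝ ι, exp (-U (ω + (ψ₀ + t₀ • h))) * ‖U' (ω + (ψ₀ + t₀ • h))‖ ∂(multivariateGaussian 0 Γ) ≤ (∫ ω : EuclideanSpace ℝ ι, exp (-U (ω + (ψ₀ + t₀
        • h))) ∂(multivariateGaussian 0 Γ)) * m₁)
    (hI2 : Integrable (fun ω : EuclideanSpace ℝ ι => exp (-U (ω + (ψ₀ + t₀ • h))) * ‖U' (ω + (ψ₀ + t₀ • h))‖ ^ 2) (multivariateGaussian 0 Γ))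
    (hm2 : ∫ ω : EuclideanSpace ℝ ι, exp (-U (ω + (ψ₀ + t₀ • h))) * ‖U' (ω + (ψ₀ + t₀ • h))‖ ^ 2 ∂(multivariateGaussian 0 Γ) ≤ (∫ ω : EuclideanSpace ℝ ι, exp (-U (ω + (ψ₀ +
        t₀ • h))) ∂(multivariateGaussian 0 Γ)) * m₂)
    (hI3 : Integrable (fun ω : EuclideanSpace ℝ ι => exp (-U (ω + (ψ₀ + t₀ • h))) * ‖U' (ω + (ψ₀ + t₀ • h))‖ ^ 3) (multivariateGaussian 0 Γ))
    (hm3 : ∫ ω : EuclideanSpace ℝ ι, exp (-U (ω + (ψ₀ + t₀ • h))) * ‖U' (ω + (ψ₀ + t₀ • h))‖ ^ 3 ∂(multivariateGaussian 0 Γ) ≤ (∫ ω : EuclideanSpace ℝ ι, exp (-U (ω + (ψ₀ +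
        t₀ • h))) ∂(multivariateGaussian 0 Γ)) * m₃) :
    HasDerivAt (fun t : ℝ => ((∫ ω : EuclideanSpace ℝ ι, exp (-U (ω + (ψ₀ + t • h))) * (U' (ω + (ψ₀ + t • h)) h * U' (ω + (ψ₀ + t • h)) h - U'' (ω + (ψ₀ + t • h)) h h)
        ∂(multivariateGaussian 0 Γ)) * (∫ ω : EuclideanSpace ℝ ι, exp (-U (ω + (ψ₀ + t • h))) ∂(multivariateGaussian 0 Γ)) - (∫ ω : EuclideanSpace ℝ ι, exp (-U (ω + (ψ₀ + t
        • h))) * -(U' (ω + (ψ₀ + t • h)) h) ∂(multivariateGaussian 0 Γ)) * (∫ ω : EuclideanSpace ℝ ι, exp (-U (ω + (ψ₀ + t • h))) * -(U' (ω + (ψ₀ + t • h)) h)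
        ∂(multivariateGaussian 0 Γ))) / (∫ ω : EuclideanSpace ℝ ι, exp (-U (ω + (ψ₀ + t • h))) ∂(multivariateGaussian 0 Γ)) ^ 2)
        (((∫ ω : EuclideanSpace ℝ ι, exp (-U (ω + (ψ₀ + t₀ • h))) * (-(U' (ω + (ψ₀ + t₀ • h)) h * U' (ω + (ψ₀ + t₀ • h)) h * U' (ω + (ψ₀ + t₀ • h)) h) + 3 * U' (ω + (ψ₀ +
            t₀ • h)) h * U'' (ω + (ψ₀ + t₀ • h)) h h - U₃ (ω + (ψ₀ + t₀ • h)) h h h) ∂(multivariateGaussian 0 Γ)) * (∫ ω : EuclideanSpace ℝ ι, exp (-U (ω + (ψ₀ + t₀ • h)))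
            ∂(multivariateGaussian 0 Γ)) ^ 2 - 3 * (∫ ω : EuclideanSpace ℝ ι, exp (-U (ω + (ψ₀ + t₀ • h))) ∂(multivariateGaussian 0 Γ)) * (∫ ω : EuclideanSpace ℝ ι, exp (-U
            (ω + (ψ₀ + t₀ • h))) * -(U' (ω + (ψ₀ + t₀ • h)) h) ∂(multivariateGaussian 0 Γ)) * (∫ ω : EuclideanSpace ℝ ι, exp (-U (ω + (ψ₀ + t₀ • h))) * (U' (ω + (ψ₀ + t₀ •
            h)) h * U' (ω + (ψ₀ + t₀ • h)) h - U'' (ω + (ψ₀ + t₀ • h)) h h) ∂(multivariateGaussian 0 Γ)) + 2 * (∫ ω : EuclideanSpace ℝ ι, exp (-U (ω + (ψ₀ + t₀ • h))) *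
            -(U' (ω + (ψ₀ + t₀ • h)) h) ∂(multivariateGaussian 0 Γ)) ^ 3) / (∫ ω : EuclideanSpace ℝ ι, exp (-U (ω + (ψ₀ + t₀ • h))) ∂(multivariateGaussian 0 Γ)) ^ 3) t₀ ∧
      |((∫ ω : EuclideanSpace ℝ ι, exp (-U (ω + (ψ₀ + t₀ • h))) * (-(U' (ω + (ψ₀ + t₀ • h)) h * U' (ω + (ψ₀ + t₀ • h)) h * U' (ω + (ψ₀ + t₀ • h)) h) + 3 * U' (ω + (ψ₀ + t₀
          • h)) h * U'' (ω + (ψ₀ + t₀ • h)) h h - U₃ (ω + (ψ₀ + t₀ • h)) h h h) ∂(multivariateGaussian 0 Γ)) * (∫ ω : EuclideanSpace ℝ ι, exp (-U (ω + (ψ₀ + t₀ • h)))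
          ∂(multivariateGaussian 0 Γ)) ^ 2 - 3 * (∫ ω : EuclideanSpace ℝ ι, exp (-U (ω + (ψ₀ + t₀ • h))) ∂(multivariateGaussian 0 Γ)) * (∫ ω : EuclideanSpace ℝ ι, exp (-U
          (ω + (ψ₀ + t₀ • h))) * -(U' (ω + (ψ₀ + t₀ • h)) h) ∂(multivariateGaussian 0 Γ)) * (∫ ω : EuclideanSpace ℝ ι, exp (-U (ω + (ψ₀ + t₀ • h))) * (U' (ω + (ψ₀ + t₀ •
          h)) h * U' (ω + (ψ₀ + t₀ • h)) h - U'' (ω + (ψ₀ + t₀ • h)) h h) ∂(multivariateGaussian 0 Γ)) + 2 * (∫ ω : EuclideanSpace ℝ ι, exp (-U (ω + (ψ₀ + t₀ • h))) * -(U'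
          (ω + (ψ₀ + t₀ • h)) h) ∂(multivariateGaussian 0 Γ)) ^ 3) / (∫ ω : EuclideanSpace ℝ ι, exp (-U (ω + (ψ₀ + t₀ • h))) ∂(multivariateGaussian 0 Γ)) ^ 3| ≤
        ‖h‖ ^ 3 * ((m₃ + 3 * κ₂ * m₁ + κ₃) + 3 * m₁ * (m₂ + κ₂) + 2 * m₁ ^ 3) := by
  have hZ := (blockZ_pos hΓ hΓop Y hUd hκ₀ hτ hδ hθ0 hθ1 hκθ hstab ψ₀ h t₀).2
  obtain ⟨-, hd1, hd2, hd3⟩ := block_line_derivs hΓ hΓop Y hUd hU'd hU''d hU₃c hκ₀ hκ₁ ha hκ₂ hκ₃ hτ hδ hθ0 hθ1 hκθ hstab hU'b hU''b hU₃b ψ₀ h t₀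
  refine ⟨hasDerivAt_logSecond_of (Z := fun t : ℝ => (∫ ω : EuclideanSpace ℝ ι, exp (-U (ω + (ψ₀ + t • h))) ∂(multivariateGaussian 0 Γ)))
      (Z₁ := fun t : ℝ => (∫ ω : EuclideanSpace ℝ ι, exp (-U (ω + (ψ₀ + t • h))) * -(U' (ω + (ψ₀ + t • h)) h) ∂(multivariateGaussian 0 Γ)))
      (Z₂ := fun t : ℝ => (∫ ω : EuclideanSpace ℝ ι, exp (-U (ω + (ψ₀ + t • h))) * (U' (ω + (ψ₀ + t • h)) h * U' (ω + (ψ₀ + t • h)) h - U'' (ω + (ψ₀ + t • h)) h h)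
          ∂(multivariateGaussian 0 Γ)))
      (z₃ := (∫ ω : EuclideanSpace ℝ ι, exp (-U (ω + (ψ₀ + t₀ • h))) * (-(U' (ω + (ψ₀ + t₀ • h)) h * U' (ω + (ψ₀ + t₀ • h)) h * U' (ω + (ψ₀ + t₀ • h)) h) + 3 * U' (ω + (ψ₀
          + t₀ • h)) h * U'' (ω + (ψ₀ + t₀ • h)) h h - U₃ (ω + (ψ₀ + t₀ • h)) h h h) ∂(multivariateGaussian 0 Γ))) hd1 hd2 hd3 hZ, ?_⟩
  have e1 := abs_blockZ1_div_le hΓ hΓop Y hUd hκ₀ hτ hδ hθ0 hθ1 hκθ hstab ψ₀ h t₀ hI1 hm1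
  have e2 := abs_blockZ2_div_le hΓ hΓop Y hUd hκ₀ hτ hδ hθ0 hθ1 hκθ hstab ψ₀ h hU''b t₀ hI2 hm2
  have e3 := abs_blockZ3_div_le hΓ hΓop Y hUd hκ₀ hτ hδ hθ0 hθ1 hκθ hstab ψ₀ h hU''b hU₃b t₀ hI1 hm1 hI3 hm3
  have n1 : 0 ≤ |(∫ ω : EuclideanSpace ℝ ι, exp (-U (ω + (ψ₀ + t₀ • h))) * -(U' (ω + (ψ₀ + t₀ • h)) h) ∂(multivariateGaussian 0 Γ))| / (∫ ω : EuclideanSpace ℝ ι, exp (-U (ω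
      + (ψ₀ + t₀ • h))) ∂(multivariateGaussian 0 Γ)) := by positivity
  have n2 : 0 ≤ |(∫ ω : EuclideanSpace ℝ ι, exp (-U (ω + (ψ₀ + t₀ • h))) * (U' (ω + (ψ₀ + t₀ • h)) h * U' (ω + (ψ₀ + t₀ • h)) h - U'' (ω + (ψ₀ + t₀ • h)) h h)
      ∂(multivariateGaussian 0 Γ))| / (∫ ω : EuclideanSpace ℝ ι, exp (-U (ω + (ψ₀ + t₀ • h))) ∂(multivariateGaussian 0 Γ)) := by positivity
  refine (abs_logThird_le hZ).trans ?_
  have p12 := mul_le_mul e1 e2 n2 (n1.trans e1)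
  have p13 := pow_le_pow_left₀ n1 e1 3
  nlinarith

/-! ## §3. THE END: the cubic Taylor letter between `ψ₀` and `ψ₀ + h` -/

/-- **THE CUBIC TAYLOR LETTER OF THE NEXT POTENTIAL OF A BLOCK-LOCAL INPUT.**  Under (405)'s hypotheses and the block tilted gradient-moment
letters UNIFORM on the segment (`∫e^{−U}‖U′(u_t)‖ᵏ ≤ Z(t)·m_k` for every `t ∈ [0,1]`, `k = 1,2,3`, integrands integrable): the third-, second-
and first-order Taylor remainders of `t ↦ log Z(ψ₀ + th)` between `t = 0` and `t = 1` are at most `‖h‖³𝔪∕6`, `‖h‖³𝔪∕2`, `‖h‖³𝔪`,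
`𝔪 = (m₃ + 3κ₂m₁ + κ₃) + 3m₁(m₂ + κ₂) + 2m₁³` — with `(log Z)′(0) = −⟨b_D(ψ₀),h⟩` ((399)∕(404)) and `(log Z)″(0) = −hᵀK_D(ψ₀)h` ((403)∕(404)):
the remainder after extracting the linear and quadratic parts of a block-local input is THIRD ORDER in `h`. [folklore] -/
theorem block_cubic_taylor (hΓ : Γ.PosSemidef) (hΓop : (γop • (1 : Matrix ι ι ℝ) - Γ).PosSemidef) (Y : Finset ι)
    (hUd : ∀ φ : EuclideanSpace ℝ ι, HasFDerivAt U (U' φ) φ) (hU'd : ∀ φ : EuclideanSpace ℝ ι, HasFDerivAt U' (U'' φ) φ)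
    (hU''d : ∀ φ : EuclideanSpace ℝ ι, HasFDerivAt U'' (U₃ φ) φ) (hU₃c : Continuous U₃)
    (hκ₀ : 0 ≤ κ₀) (hκ₁ : 0 ≤ κ₁) (ha : 0 ≤ a) (hκ₂ : 0 ≤ κ₂) (hκ₃ : 0 ≤ κ₃) (hτ : 0 < τ) (hδ : 0 < δ) (hθ0 : 0 < θ) (hθ1 : θ < 1)
    (hκθ : (2 * κ₀ * (1 + τ) + 4 * δ) * γop ≤ θ) (hstab : ∀ φ : EuclideanSpace ℝ ι, -(κ₀ * ∑ x ∈ Y, φ x ^ 2) ≤ U φ)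
    (hU'b : ∀ φ : EuclideanSpace ℝ ι, ‖U' φ‖ ≤ κ₁ * (a + ∑ x ∈ Y, φ x ^ 2)) (hU''b : ∀ φ : EuclideanSpace ℝ ι, ‖U'' φ‖ ≤ κ₂)
    (hU₃b : ∀ φ : EuclideanSpace ℝ ι, ‖U₃ φ‖ ≤ κ₃) (ψ₀ h : EuclideanSpace ℝ ι) {m₁ m₂ m₃ : ℝ}
    (hI1 : ∀ t ∈ Icc (0 : ℝ) 1, Integrable (fun ω : EuclideanSpace ℝ ι => exp (-U (ω + (ψ₀ + t • h))) * ‖U' (ω + (ψ₀ + t • h))‖) (multivariateGaussian 0 Γ))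
    (hm1 : ∀ t ∈ Icc (0 : ℝ) 1, ∫ ω : EuclideanSpace ℝ ι, exp (-U (ω + (ψ₀ + t • h))) * ‖U' (ω + (ψ₀ + t • h))‖ ∂(multivariateGaussian 0 Γ) ≤ (∫ ω : EuclideanSpace ℝ ι, exp
        (-U (ω + (ψ₀ + t • h))) ∂(multivariateGaussian 0 Γ)) * m₁)
    (hI2 : ∀ t ∈ Icc (0 : ℝ) 1, Integrable (fun ω : EuclideanSpace ℝ ι => exp (-U (ω + (ψ₀ + t • h))) * ‖U' (ω + (ψ₀ + t • h))‖ ^ 2) (multivariateGaussian 0 Γ))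
    (hm2 : ∀ t ∈ Icc (0 : ℝ) 1, ∫ ω : EuclideanSpace ℝ ι, exp (-U (ω + (ψ₀ + t • h))) * ‖U' (ω + (ψ₀ + t • h))‖ ^ 2 ∂(multivariateGaussian 0 Γ) ≤ (∫ ω : EuclideanSpace ℝ ι,
        exp (-U (ω + (ψ₀ + t • h))) ∂(multivariateGaussian 0 Γ)) * m₂)
    (hI3 : ∀ t ∈ Icc (0 : ℝ) 1, Integrable (fun ω : EuclideanSpace ℝ ι => exp (-U (ω + (ψ₀ + t • h))) * ‖U' (ω + (ψ₀ + t • h))‖ ^ 3) (multivariateGaussian 0 Γ))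
    (hm3 : ∀ t ∈ Icc (0 : ℝ) 1, ∫ ω : EuclideanSpace ℝ ι, exp (-U (ω + (ψ₀ + t • h))) * ‖U' (ω + (ψ₀ + t • h))‖ ^ 3 ∂(multivariateGaussian 0 Γ) ≤ (∫ ω : EuclideanSpace ℝ ι,
        exp (-U (ω + (ψ₀ + t • h))) ∂(multivariateGaussian 0 Γ)) * m₃) :
    |Real.log (∫ ω : EuclideanSpace ℝ ι, exp (-U (ω + (ψ₀ + (1 : ℝ) • h))) ∂(multivariateGaussian 0 Γ)) - Real.log (∫ ω : EuclideanSpace ℝ ι, exp (-U (ω + (ψ₀ + (0 : ℝ) •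
        h))) ∂(multivariateGaussian 0 Γ)) - (∫ ω : EuclideanSpace ℝ ι, exp (-U (ω + (ψ₀ + (0 : ℝ) • h))) * -(U' (ω + (ψ₀ + (0 : ℝ) • h)) h) ∂(multivariateGaussian 0 Γ)) /
        (∫ ω : EuclideanSpace ℝ ι, exp (-U (ω + (ψ₀ + (0 : ℝ) • h))) ∂(multivariateGaussian 0 Γ)) - ((∫ ω : EuclideanSpace ℝ ι, exp (-U (ω + (ψ₀ + (0 : ℝ) • h))) * (U' (ω +
        (ψ₀ + (0 : ℝ) • h)) h * U' (ω + (ψ₀ + (0 : ℝ) • h)) h - U'' (ω + (ψ₀ + (0 : ℝ) • h)) h h) ∂(multivariateGaussian 0 Γ)) * (∫ ω : EuclideanSpace ℝ ι, exp (-U (ω + (ψ₀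
        + (0 : ℝ) • h))) ∂(multivariateGaussian 0 Γ)) - (∫ ω : EuclideanSpace ℝ ι, exp (-U (ω + (ψ₀ + (0 : ℝ) • h))) * -(U' (ω + (ψ₀ + (0 : ℝ) • h)) h)
        ∂(multivariateGaussian 0 Γ)) * (∫ ω : EuclideanSpace ℝ ι, exp (-U (ω + (ψ₀ + (0 : ℝ) • h))) * -(U' (ω + (ψ₀ + (0 : ℝ) • h)) h) ∂(multivariateGaussian 0 Γ))) / (∫ ω
        : EuclideanSpace ℝ ι, exp (-U (ω + (ψ₀ + (0 : ℝ) • h))) ∂(multivariateGaussian 0 Γ)) ^ 2 / 2| ≤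
        ‖h‖ ^ 3 * ((m₃ + 3 * κ₂ * m₁ + κ₃) + 3 * m₁ * (m₂ + κ₂) + 2 * m₁ ^ 3) / 6 ∧
      |(∫ ω : EuclideanSpace ℝ ι, exp (-U (ω + (ψ₀ + (1 : ℝ) • h))) * -(U' (ω + (ψ₀ + (1 : ℝ) • h)) h) ∂(multivariateGaussian 0 Γ)) / (∫ ω : EuclideanSpace ℝ ι, exp (-U (ω
          + (ψ₀ + (1 : ℝ) • h))) ∂(multivariateGaussian 0 Γ)) - (∫ ω : EuclideanSpace ℝ ι, exp (-U (ω + (ψ₀ + (0 : ℝ) • h))) * -(U' (ω + (ψ₀ + (0 : ℝ) • h)) h)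
          ∂(multivariateGaussian 0 Γ)) / (∫ ω : EuclideanSpace ℝ ι, exp (-U (ω + (ψ₀ + (0 : ℝ) • h))) ∂(multivariateGaussian 0 Γ)) - ((∫ ω : EuclideanSpace ℝ ι, exp (-U (ω
          + (ψ₀ + (0 : ℝ) • h))) * (U' (ω + (ψ₀ + (0 : ℝ) • h)) h * U' (ω + (ψ₀ + (0 : ℝ) • h)) h - U'' (ω + (ψ₀ + (0 : ℝ) • h)) h h) ∂(multivariateGaussian 0 Γ)) * (∫ ω :
          EuclideanSpace ℝ ι, exp (-U (ω + (ψ₀ + (0 : ℝ) • h))) ∂(multivariateGaussian 0 Γ)) - (∫ ω : EuclideanSpace ℝ ι, exp (-U (ω + (ψ₀ + (0 : ℝ) • h))) * -(U' (ω + (ψ₀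
          + (0 : ℝ) • h)) h) ∂(multivariateGaussian 0 Γ)) * (∫ ω : EuclideanSpace ℝ ι, exp (-U (ω + (ψ₀ + (0 : ℝ) • h))) * -(U' (ω + (ψ₀ + (0 : ℝ) • h)) h)
          ∂(multivariateGaussian 0 Γ))) / (∫ ω : EuclideanSpace ℝ ι, exp (-U (ω + (ψ₀ + (0 : ℝ) • h))) ∂(multivariateGaussian 0 Γ)) ^ 2| ≤
        ‖h‖ ^ 3 * ((m₃ + 3 * κ₂ * m₁ + κ₃) + 3 * m₁ * (m₂ + κ₂) + 2 * m₁ ^ 3) / 2 ∧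
      |((∫ ω : EuclideanSpace ℝ ι, exp (-U (ω + (ψ₀ + (1 : ℝ) • h))) * (U' (ω + (ψ₀ + (1 : ℝ) • h)) h * U' (ω + (ψ₀ + (1 : ℝ) • h)) h - U'' (ω + (ψ₀ + (1 : ℝ) • h)) h h)
          ∂(multivariateGaussian 0 Γ)) * (∫ ω : EuclideanSpace ℝ ι, exp (-U (ω + (ψ₀ + (1 : ℝ) • h))) ∂(multivariateGaussian 0 Γ)) - (∫ ω : EuclideanSpace ℝ ι, exp (-U (ω +
          (ψ₀ + (1 : ℝ) • h))) * -(U' (ω + (ψ₀ + (1 : ℝ) • h)) h) ∂(multivariateGaussian 0 Γ)) * (∫ ω : EuclideanSpace ℝ ι, exp (-U (ω + (ψ₀ + (1 : ℝ) • h))) * -(U' (ω +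
          (ψ₀ + (1 : ℝ) • h)) h) ∂(multivariateGaussian 0 Γ))) / (∫ ω : EuclideanSpace ℝ ι, exp (-U (ω + (ψ₀ + (1 : ℝ) • h))) ∂(multivariateGaussian 0 Γ)) ^ 2 - ((∫ ω :
          EuclideanSpace ℝ ι, exp (-U (ω + (ψ₀ + (0 : ℝ) • h))) * (U' (ω + (ψ₀ + (0 : ℝ) • h)) h * U' (ω + (ψ₀ + (0 : ℝ) • h)) h - U'' (ω + (ψ₀ + (0 : ℝ) • h)) h h)
          ∂(multivariateGaussian 0 Γ)) * (∫ ω : EuclideanSpace ℝ ι, exp (-U (ω + (ψ₀ + (0 : ℝ) • h))) ∂(multivariateGaussian 0 Γ)) - (∫ ω : EuclideanSpace ℝ ι, exp (-U (ω +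
          (ψ₀ + (0 : ℝ) • h))) * -(U' (ω + (ψ₀ + (0 : ℝ) • h)) h) ∂(multivariateGaussian 0 Γ)) * (∫ ω : EuclideanSpace ℝ ι, exp (-U (ω + (ψ₀ + (0 : ℝ) • h))) * -(U' (ω +
          (ψ₀ + (0 : ℝ) • h)) h) ∂(multivariateGaussian 0 Γ))) / (∫ ω : EuclideanSpace ℝ ι, exp (-U (ω + (ψ₀ + (0 : ℝ) • h))) ∂(multivariateGaussian 0 Γ)) ^ 2| ≤
        ‖h‖ ^ 3 * ((m₃ + 3 * κ₂ * m₁ + κ₃) + 3 * m₁ * (m₂ + κ₂) + 2 * m₁ ^ 3) := by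
  exact taylor_third_abs_one (g := fun t : ℝ => Real.log (∫ ω : EuclideanSpace ℝ ι, exp (-U (ω + (ψ₀ + t • h))) ∂(multivariateGaussian 0 Γ)))
    (g₁ := fun t : ℝ => (∫ ω : EuclideanSpace ℝ ι, exp (-U (ω + (ψ₀ + t • h))) * -(U' (ω + (ψ₀ + t • h)) h) ∂(multivariateGaussian 0 Γ)) / (∫ ω : EuclideanSpace ℝ ι, exp
        (-U (ω + (ψ₀ + t • h))) ∂(multivariateGaussian 0 Γ)))
    (g₂ := fun t : ℝ => ((∫ ω : EuclideanSpace ℝ ι, exp (-U (ω + (ψ₀ + t • h))) * (U' (ω + (ψ₀ + t • h)) h * U' (ω + (ψ₀ + t • h)) h - U'' (ω + (ψ₀ + t • h)) h h)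
        ∂(multivariateGaussian 0 Γ)) * (∫ ω : EuclideanSpace ℝ ι, exp (-U (ω + (ψ₀ + t • h))) ∂(multivariateGaussian 0 Γ)) - (∫ ω : EuclideanSpace ℝ ι, exp (-U (ω + (ψ₀ + t
        • h))) * -(U' (ω + (ψ₀ + t • h)) h) ∂(multivariateGaussian 0 Γ)) * (∫ ω : EuclideanSpace ℝ ι, exp (-U (ω + (ψ₀ + t • h))) * -(U' (ω + (ψ₀ + t • h)) h)
        ∂(multivariateGaussian 0 Γ))) / (∫ ω : EuclideanSpace ℝ ι, exp (-U (ω + (ψ₀ + t • h))) ∂(multivariateGaussian 0 Γ)) ^ 2)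
    (g₃ := fun t : ℝ => ((∫ ω : EuclideanSpace ℝ ι, exp (-U (ω + (ψ₀ + t • h))) * (-(U' (ω + (ψ₀ + t • h)) h * U' (ω + (ψ₀ + t • h)) h * U' (ω + (ψ₀ + t • h)) h) + 3 * U'
        (ω + (ψ₀ + t • h)) h * U'' (ω + (ψ₀ + t • h)) h h - U₃ (ω + (ψ₀ + t • h)) h h h) ∂(multivariateGaussian 0 Γ)) * (∫ ω : EuclideanSpace ℝ ι, exp (-U (ω + (ψ₀ + t •
        h))) ∂(multivariateGaussian 0 Γ)) ^ 2 - 3 * (∫ ω : EuclideanSpace ℝ ι, exp (-U (ω + (ψ₀ + t • h))) ∂(multivariateGaussian 0 Γ)) * (∫ ω : EuclideanSpace ℝ ι, exp (-U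
        (ω + (ψ₀ + t • h))) * -(U' (ω + (ψ₀ + t • h)) h) ∂(multivariateGaussian 0 Γ)) * (∫ ω : EuclideanSpace ℝ ι, exp (-U (ω + (ψ₀ + t • h))) * (U' (ω + (ψ₀ + t • h)) h *
        U' (ω + (ψ₀ + t • h)) h - U'' (ω + (ψ₀ + t • h)) h h) ∂(multivariateGaussian 0 Γ)) + 2 * (∫ ω : EuclideanSpace ℝ ι, exp (-U (ω + (ψ₀ + t • h))) * -(U' (ω + (ψ₀ + t
        • h)) h) ∂(multivariateGaussian 0 Γ)) ^ 3) / (∫ ω : EuclideanSpace ℝ ι, exp (-U (ω + (ψ₀ + t • h))) ∂(multivariateGaussian 0 Γ)) ^ 3)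
    (fun t _ => (block_logZ_derivs hΓ hΓop Y hUd hU'd hU''d hU₃c hκ₀ hκ₁ ha hκ₂ hκ₃ hτ hδ hθ0 hθ1 hκθ hstab hU'b hU''b hU₃b ψ₀ h t).1) (fun t _ => (block_logZ_derivs hΓ
        hΓop Y hUd hU'd hU''d hU₃c hκ₀ hκ₁ ha hκ₂ hκ₃ hτ hδ hθ0 hθ1 hκθ hstab hU'b hU''b hU₃b ψ₀ h t).2)
    (fun t ht => (block_third_letter hΓ hΓop Y hUd hU'd hU''d hU₃c hκ₀ hκ₁ ha hκ₂ hκ₃ hτ hδ hθ0 hθ1 hκθ hstab hU'b hU''b hU₃b ψ₀ h t (hI1 t ht) (hm1 t ht) (hI2 t ht) (hm2 t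
        ht) (hI3 t ht) (hm3 t ht)).1)
    (fun t ht => (block_third_letter hΓ hΓop Y hUd hU'd hU''d hU₃c hκ₀ hκ₁ ha hκ₂ hκ₃ hτ hδ hθ0 hθ1 hκθ hstab hU'b hU''b hU₃b ψ₀ h t (hI1 t ht) (hm1 t ht) (hI2 t ht) (hm2 t
        ht) (hI3 t ht) (hm3 t ht)).2)

end Main

/-! ## §4. Toy -/

/-- Toy (§2's letter algebra): with `‖h‖ = 1`, `m₁ = m₂ = m₃ = κ₂ = κ₃ = 0` the cubic letter vanishes. -/
example : (1 : ℝ) ^ 3 * ((0 + 3 * 0 * 0 + 0) + 3 * 0 * (0 + 0) + 2 * 0 ^ 3) = 0 := by norm_num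

end Summit.QuantumFields.BalabanUV.T4Continuum.NE7b.SupBlockThirdLetter
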